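import Summits.BirchSwinnertonDyer.BirchSwinnertonDyer.Theorems.ByReductionTypeAtTwoAdditivePotMultConjATwoNarrowStampsELayer
import HarnessLib

/-!
# C4″ `AdditivePotMultOverKAtTwo` (item stmt-BirchSwinnertonDyer-22618), the (I1M′) input of the upper half on the `0 < Δ` rows:
# NARROW STAMPS, part E / ROWS — UNCONDITIONAL statement (A) at `2` (ZERO hypotheses) for the C4″ census curves 92720p1
# (`Δ > 0`, `2`-torsion field of discriminant `46360`), by the narrow road

Cell `bsd-2adic`, rung K4, seat `bsd-2adic-k4-w3` GEN 12 (explicit unit of director-bsd g16 (309)(7); `--supports stmt-BirchSwinnertonDyer-22618`).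
HONEST FRAMING (D-0036/D-0054/D-0152): THEOREMS ONLY (no definition, no named fact, no `sorry`, no instance). The five files `…NarrowStampsE{{Class,Field,Units,Layer,Rows}}`
carry k4-w1's zero-hypothesis narrow-Fukuda road (`conjA_two_445508b1''`) for ONE totally real cubic field `ℚ(θ)` (eng-2's reduced cubic of the rows'
`2`-division field, or an odd-index generator of it) through the GEN 12 kit (`…NarrowRoadKit{{,Squares,Doors,Real}}`): FIELD = `irreducible_cubic_d46360p`,
`odd_classNumber_of_root_d46360p` (norm certificate below the Minkowski bound, GEN 11's generator), `exists_three_ringHom_adjoin_d46360p` / `isTotallyReal_adjoin_d46360p`,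
`unitCertificate_adjoin_d46360p` / `card_totPosUnitsModSq_adjoin_d46360p` (`#(U⁺/U²) = 2`: a mixed-sign unit and a totally positive unit that is a quadratic non-residue
modulo a principal prime), `layerOneBit_d46360p` (`2 ∤ h(ℚ(θ,√2))`: Chevalley's door at `2` with a `2`-adic non-norm unit, k4-w1 `layerOneBit_of_chevalleyCert`),
`totallyRamifiedFrom_zero_adjoin_d46360p` (even-index certificate); LAYER = `card_totPosUnitsModSq_sup_layer_one_d46360p` (five units of `ℚ(θ,√2)`, algebraic integers by
their monic sextics: UNITS file `layerUnits_d46360p`, with an invertible `5 × 5` sign matrix at five real embeddings, every entry by rational interval arithmetic on the located roots) and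
**`narrowIndex_eq_d46360p`** (both narrow indices `= 2`); ROWS = `conjA_two_<L>'`, Coates–Sujatha's statement (A) at `p = 2` for the census cubic model of each
Cremona class, PROVED OUTRIGHT by the kit's door `conjA_two_cubicModel_of_narrowRoad` (cruxlead-19573-w2's NARROW FUKUDA + Kida-lite + kernel Lim 3.5@2).
All certificates were found by the seat's exact-arithmetic tools (`tools/narrowcert.py`: k4-w2 GEN 12's unit lattice search `nf6/units`, GEN 11's `index3/cubiccert5`
for the `2`-adic and class-number data, `fieldiso`) and are CHECKED HERE by the kernel; eng-2's certified numerics (CERT-ADD-POTMULT-POS81-AB-E2: `(a) ORDER cert ∧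
(b) NARROW-EQUAL01 cert`, `h⁺ = 2h` at layers `0, 1`) agree. These are the FIRST kernel (A)₂ rows on the `Δ > 0` half of (I1M′). Statement (A) is NOT BSD:
BSD₂ for these curves is not proved; C4″ / (I1M′) stay research-open; nothing booked; no row of 22618 changes tier (pen RC-490 (4)); BSD is not proved by any of this.

References: [CoatesSujatha2005] Conj. A, Thm. 3.4; [Fukuda1994] Thm. 1 (2); [FrohlichTaylor1990] Ch. V §1 (1.8)–(1.13); [Lang1990] Ch. 13 §4 Lemma 4.1;
[Washington1997] §13.1, Prop. 13.2; [Cohen1993] §4.1.3, §6.3; [Marcus1977] Ch. 5 Thm. 22, 35–37; cell file `eng2/fukuda269/pos81/TABLE-ADD-POTMULT-POS81-AB-E2-v1.tsv`.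
-/

set_option autoImplicit false
-- sibling precedent (`…NarrowRankStamp445508b1.lean`): the directory name repeats the summit name
set_option linter.dupNamespace false

noncomputable section
open scoped Classical IntermediateField NumberField Real nonZeroDivisors
namespace Summit.BirchSwinnertonDyer.BirchSwinnertonDyer.Theorems.AddKatoTwo
open WeierstrassCurve Field Polynomial IsDedekindDomain NumberField Matrix IntermediateField Literature.NumberTheory.EllipticCurves
  Literature.NumberTheory.EllipticCurves.ZpExtension
  Literature.NumberTheory.GaloisRepresentations Literature.NumberTheory.IwasawaTheory Literature.NumberTheory.NumberFields
  Literature.Geometry.Kaehler.ComplexTorus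
  Summit.BirchSwinnertonDyer.BirchSwinnertonDyer.Theorems.SteinbergFibreAtTwo
  Summit.BirchSwinnertonDyer.BirchSwinnertonDyer.Theorems.AlignedTransportAtTwoTorsionPointField
  Summit.BirchSwinnertonDyer.BirchSwinnertonDyer.Theorems.SteinbergFibreAtTwo.NarrowRankCert

/-! ## The census rows with `2`-torsion field `ℚ(θ)` -/

/-- The census cubic model of the C4″ row `92720p1` (`y² = x³ + (0)x² + (-1336003)x + (-590663998)`, addL2x GEN 13 `nst_census` a-invariants) is an elliptic curve. -/
theorem isElliptic_92720p1' : (⟨0, ((0 : ℤ) : ℚ), 0, ((-1336003 : ℤ) : ℚ), ((-590663998 : ℤ) : ℚ)⟩ : WeierstrassCurve ℚ).IsElliptic :=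
  isElliptic_cubicModel _ _ _ (by simp only [Cubic.discr]; norm_num)

/-- **UNCONDITIONAL (A)₂ for the C4″ census curve `92720p1` — ZERO hypotheses, ZERO named facts** (additive potentially multiplicative at `2`,
irreducible `E[2]`, `Δ > 0`: `2`-torsion cubic field `ℚ(θ)`, `θ³ + (0)θ² + (-97)θ + (-226) = 0`, totally real, `d = 46360`, `2 = 𝔭𝔮²`). Coates–Sujatha's
statement (A) at `p = 2` for the cubic model `y² = x³ + (0)x² + (-1336003)x + (-590663998)`: for every cyclotomic `ℤ₂`-extension of `ℚ` the dual fine Selmer group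
over `ℚ_∞` is finitely generated over `ℤ₂` (`∃ γ D` currency). KERNEL by the NARROW ROAD (kit `conjA_two_cubicModel_of_narrowRoad`): the root `β = x(T)` of
the curve's cubic is `-8342 / 7 + (-1034 / 7)θ + (129 / 7)θ²`, `ℚ(β) = ℚ(θ)`; `ℚ(θ)` totally real (`isTotallyReal_adjoin_d46360p`); Fukuda's index `0`
(`totallyRamifiedFrom_zero_adjoin_d46360p`); `[Cl⁺(ℚ(θ,√2)) : (Cl⁺)²] = [Cl⁺(ℚ(θ)) : (Cl⁺)²]` (`narrowIndex_eq_d46360p`); then cruxlead-19573-w2's NARROW FUKUDA +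
Kida-lite + kernel Lim 3.5@2. This discharges the (I1M′) input of this `Δ > 0` row (GEN 10 `hAnaMI_posDisc_of_cubicFieldNarrowMu` habitat) in the kernel; eng-2's
POS81-AB letters for the row: `(a) ORDER cert, (b) NARROW-EQUAL01 cert`. It is statement (A), NOT BSD: BSD₂ for `92720p1` is NOT proved by this.
[cite: CoatesSujatha2005, Conj. A and Thm. 3.4] [cite: Fukuda1994, Thm. 1 (2), p. 264] [cite: FrohlichTaylor1990, Ch. V §1 (1.12)–(1.13)] -/
theorem conjA_two_92720p1' (κ : ZpExtension ℚ 2) (hκ : κ.IsCyclotomic) :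
    haveI := isElliptic_92720p1'
    ∃ (γ : absoluteGaloisGroup ℚ) (D : (⟨0, ((0 : ℤ) : ℚ), 0, ((-1336003 : ℤ) : ℚ), ((-590663998 : ℤ) : ℚ)⟩ : WeierstrassCurve ℚ).FineSelmerDualData κ γ),
      Module.Finite ℤ_[2] (RestrictScalars ℤ_[2] (IwasawaAlgebra 2) D.X) := by
  haveI := isElliptic_92720p1'
  obtain ⟨θ, hθ⟩ : ∃ θ : AlgebraicClosure ℚ, aeval θ (Cubic.toPoly ⟨1, ((0 : ℤ) : ℚ), ((-97 : ℤ) : ℚ), ((-226 : ℤ) : ℚ)⟩) = 0 :=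
    IsAlgClosed.exists_aeval_eq_zero _ _ (by rw [Cubic.degree_of_a_ne_zero one_ne_zero]; norm_num)
  have hθ' : θ ^ 3 + (0 : AlgebraicClosure ℚ) * θ ^ 2 + (-97 : AlgebraicClosure ℚ) * θ + (-226 : AlgebraicClosure ℚ) = 0 := by
    have := hθ
    simp only [Cubic.toPoly, map_one, one_mul, aeval_add, aeval_mul, aeval_C, aeval_X_pow, aeval_X,
      eq_ratCast, Rat.cast_intCast] at this
    push_cast at this
    linear_combination this
  set β : AlgebraicClosure ℚ := algebraMap ℚ (AlgebraicClosure ℚ) (-8342 / 7 : ℚ) +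
      algebraMap ℚ (AlgebraicClosure ℚ) (-1034 / 7 : ℚ) * θ + algebraMap ℚ (AlgebraicClosure ℚ) (129 / 7 : ℚ) * θ ^ 2 with hβdef
  have hβ : aeval β (Cubic.toPoly ⟨1, ((0 : ℤ) : ℚ), ((-1336003 : ℤ) : ℚ), ((-590663998 : ℤ) : ℚ)⟩) = 0 := by
    simp only [Cubic.toPoly, map_one, one_mul, aeval_add, aeval_mul, aeval_C, aeval_X_pow, aeval_X, eq_ratCast,
      Rat.cast_intCast]
    rw [hβdef]
    simp only [eq_ratCast]
    push_cast
    linear_combination (((1048703428 : AlgebraicClosure ℚ) / 343) + ((29362077 : AlgebraicClosure ℚ) / 49) * θ + ((-51620382 : AlgebraicClosure ℚ) / 343) * θ ^ 2 + ((2146689 : AlgebraicClosure ℚ) / 343) * θ ^ 3) * hθ'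
  have hadj : IntermediateField.adjoin ℚ {θ} = IntermediateField.adjoin ℚ {β} := by
    apply le_antisymm
    · rw [IntermediateField.adjoin_simple_le_iff]
      have hθeq : θ = algebraMap ℚ (AlgebraicClosure ℚ) (57448129 / 800000 : ℚ) +
          algebraMap ℚ (AlgebraicClosure ℚ) (75871 / 1600000 : ℚ) * β +
          algebraMap ℚ (AlgebraicClosure ℚ) (-129 / 1600000 : ℚ) * β ^ 2 := by
        rw [hβdef]; simp only [eq_ratCast]; push_cast
        linear_combination (((-8603397 : AlgebraicClosure ℚ) / 19600000) + ((2146689 : AlgebraicClosure ℚ) / 78400000) * θ) * hθ'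
      rw [hθeq]
      have hβmem := IntermediateField.mem_adjoin_simple_self ℚ β
      exact add_mem (add_mem (_root_.algebraMap_mem _ _) (mul_mem (_root_.algebraMap_mem _ _) hβmem))
        (mul_mem (_root_.algebraMap_mem _ _) (pow_mem hβmem 2))
    · rw [IntermediateField.adjoin_simple_le_iff, hβdef]
      have hθmem := IntermediateField.mem_adjoin_simple_self ℚ θ
      exact add_mem (add_mem (_root_.algebraMap_mem _ _) (mul_mem (_root_.algebraMap_mem _ _) hθmem))
        (mul_mem (_root_.algebraMap_mem _ _) (pow_mem hθmem 2))
  exact conjA_two_cubicModel_of_narrowRoad (0) (-1336003) (-590663998) hβ irreducible_cubic_d46360p hθ hadj (isTotallyReal_adjoin_d46360p hθ)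
    (totallyRamifiedFrom_zero_adjoin_d46360p hθ) (narrowIndex_eq_d46360p hθ) κ hκ

end Summit.BirchSwinnertonDyer.BirchSwinnertonDyer.Theorems.AddKatoTwo

end
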